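import Summits.Ventures.WeilGRH.UniformConductorFloorPrincipalMod283Log12EvenA
import Summits.Ventures.WeilGRH.UniformConductorFloorPrincipalMod283Log12EvenB
import Summits.Ventures.WeilGRH.UniformConductorFloorPrincipalMod283Log12EvenC
import Summits.Ventures.WeilGRH.UniformConductorFloorLog12TableValid
import Summits.Ventures.WeilGRH.TwistedDataRungAW
import Summits.Ventures.WeilGRH.TwistedGramEvenReal
import HarnessLib

/-!
# The PRINCIPAL character mod 283 at `a = (log 12)/2`: Weil positivity on `[−(log 12)/2, (log 12)/2]` (door E, character-weighted prime constant, the `S = 2^80` table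
  `Log12Table`) — hence EVERY character mod 283 (one of the door primes `281`, `283`, `293` of rung six)

Cell `rh-explicit`, WEIL TRACK — GRH ARM (weil-grh-1 gen10; gen9's door-E cell for `χ₀` mod 283 at `(log 12)/2` — weil-grh-2 gen13's pipeline
re-pointed at the `S = 2^80` table `Log12Table` — re-cut into gate-sized files: at this window (eight prime powers, far block `B₃ = 127`)
one even ROW of the cell check sits at the kernel memory guard, so the even rows are checked by column HALVES (`TwistedGramCellCheckColsE.lean`)
and re-glued; the mathematics, the data and the door are unchanged).
By `UniformFloor.WeilPositivityOnChar.of_principal` the all-characters statement `U_{(log 12)/2}(283)` is EQUIVALENT to the positivity of `χ₀ = 1` mod 283; the primes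
`277` (razor, FALSE: `…PrincipalMod277Log12.lean`), `281`, `283`, `293` are left open at this rung by `UniformConductorFloorPrincipalLog12.lean` / `…JointFloorsLog12.lean`
(flat threshold `271.53`, uniform floor `296`; Galerkin bottoms of the coprime form `277.05` (32 modes) / `277.13` (48)).  Kernel-checked INSTANCE of weil-grh-5's door
`weilPositivityOnChar_of_twisted_formatC_dataAW` for `χ₀` mod 283: real, even, prime signs `ε = (1, 1, 1, 1, 1, 1, 1, 1)` on `2, 3, 4, 5, 7, 8, 9, 11`, `log q = log 283`;
blocks `10 × 127 ∣ 16 × 40`, `θ = 3/64 ∣ 806/64`, kernel margins `λ = 0.0010 ∣ 2.1948`; the special-value table `Log12Table.tab` (`S = 2^80`, modes `< 128`, `tab_valid`);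
floors `[3, 2, 1, 1, 1, 1, 1, 1]` by the kernel interval test `TwistedEncl.checkFloors` via `TwistedEncl.mem_aopBoxW` (no `AopFloors` dependency at this window).  Data and kernel facts: `…PrincipalMod283Log12Data.lean`,
`…Even{A,B,C}.lean`; this file: the typed door and the theorem.  RH/GRH-free; standard axioms.  References: H. Yoshida (1992) §§5–7 [Yoshida1992HermitianForms]; R. E. Moore (1966) Ch. 3 [Moore1966]; N. J. Higham (2002) [Higham2002ASNA].
-/

noncomputable section

namespace Summit.Ventures.WeilGRH.PrincipalMod283Log12
open Literature.NumberTheory.LFunctions Literature.NumberTheory.LFunctions.Yoshida1992 Encl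
open Literature.Analysis.ValidatedNumerics.NumericsMP Literature.Analysis.SpecialFunctions
open Summit.Ventures.WeilGRH.Log12Table
open Summit.Ventures.WeilGRH.TwistedEncl
open scoped Real ComplexConjugate ArithmeticFunction.vonMangoldt

/-- `log 283 ∈ LQ283`. [folklore] -/
theorem hLQ283 : MI.mem (2 ^ 80) (Real.log (283 : ℕ)) LQ283 := MI.mem_logNat (by positivity) tLQ283
/-- `a(1+E(2a)) ∈ CC283`. [folklore] -/
theorem hCC283 : MI.mem (2 ^ 80) (a * (1 + weilArchDensity (2 * a))) CC283 := mem_ccBox (by positivity) consts_valid tCC283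

/-- kernel: the prime-constant floors `⌊2a/log k⌋ = [3, 2, 1, 1, 1, 1, 1, 1]` on `k = 2, 3, 4, 5, 7, 8, 9, 11` by the interval test `checkFloors` (no exact
boundary at this window). [cite: Moore1966, Ch. 3 (interval arithmetic: inclusion property)] -/
theorem tFL283 : TwistedEncl.checkFloors C [3, 2, 1, 1, 1, 1, 1, 1] = true := by decide +kernel

/-- ★ The CHARACTER-WEIGHTED door `weilPositivityOnChar_of_twisted_formatC_dataAW` at `a = (log 12)/2` for modulus 283, specialised to this file's boxes and the
`S = 2^80` table `Log12Table.tab` (valid below `128`): every remaining hypothesis is a kernel fact about the cell data or the character's reality and prime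
signs. [cite: Yoshida1992HermitianForms, §7 pp. 305–312] -/
theorem rung283 (χ : DirichletCharacter ℂ 283) (hreal : ∀ n : ℕ, conj (χ (n : ZMod 283)) = χ (n : ZMod 283))
    (hε : ∀ i < ks.length, (χ (((ks.getD i default).val : ℕ) : ZMod 283)).re = ((εs283.getD i 0 : ℤ) : ℝ))
    {dE : EvenCellData} {dO : OddCellData} (hNe : dE.B3 < 128) (hNo : dO.B3 + 1 < 128)
    (hCCe : dE.CC = CC283) (hAOPe : dE.AOP = AOP283) (hCCo : dO.CC = CC283) (hAOPo : dO.AOP = AOP283)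
    (tSE : checkSignsE (2 ^ 80) C LQ283 tab dE = true) (tSO : checkSignsOA (2 ^ 80) 128 C LQ283 tab dO = true)
    {ρe δe ρo δo : ℤ} {DE LE DO LO : List (List ℤ)}
    (tE : checkCellE (2 ^ 80) C εs283 LQ283 tab dE 60 ρe DE = true) (tPE : PsdDyadic.checkPsdMid dE.B δe ρe DE LE = true)
    (tO : checkCellO (2 ^ 80) C εs283 LQ283 tab dO 60 ρo DO = true) (tPO : PsdDyadic.checkPsdMid dO.B δo ρo DO LO = true) :
    WeilPositivityOnChar χ (Real.log 12 / 2) := by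
    have hS : 0 < (2 : ℕ) ^ 80 := by positivity
    have hT : TabValid (2 ^ 80) a ks 128 tab := tab_valid
    have hAOP : MI.mem (2 ^ 80) (∑ j ∈ weilPrimeIndex a, |(χ (j : ZMod 283)).re| * ((Λ j : ℝ) / Real.sqrt j *
        (2 * Real.cos (π / (⌊2 * a / Real.log j⌋₊ + 2))))) AOP283 :=
      mem_aopBoxW hS a_pos primeData consts_valid χ hε tFL283 tAOP283
    have hCCe' : MI.mem (2 ^ 80) (a * (1 + weilArchDensity (2 * a))) dE.CC := by rw [hCCe]; exact hCC283
    have hCCo' : MI.mem (2 ^ 80) (a * (1 + weilArchDensity (2 * a))) dO.CC := by rw [hCCo]; exact hCC283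
    have hAOPe' : MI.mem (2 ^ 80) (∑ j ∈ weilPrimeIndex a, |(χ (j : ZMod 283)).re| * ((Λ j : ℝ) / Real.sqrt j *
        (2 * Real.cos (π / (⌊2 * a / Real.log j⌋₊ + 2))))) dE.AOP := by rw [hAOPe]; exact hAOP
    have hAOPo' : MI.mem (2 ^ 80) (∑ j ∈ weilPrimeIndex a, |(χ (j : ZMod 283)).re| * ((Λ j : ℝ) / Real.sqrt j *
        (2 * Real.cos (π / (⌊2 * a / Real.log j⌋₊ + 2))))) dO.AOP := by rw [hAOPo]; exact hAOP
    obtain ⟨hB2, hBB3, hθN, hθD, -, -, -⟩ := checkCellE_spec tE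
    obtain ⟨hB1, hBB3o, hθNo, hθDo, -, -, -⟩ := checkCellO_spec tO
    obtain ⟨h0e, hd0e, hwe⟩ := signsE_of_checkSignsE_A hS a_pos consts_valid hLQ283 hT (d := dE) hNe hCCe' hAOPe' tSE
    obtain ⟨h0o, hd0o, hwo⟩ := signsO_of_checkSignsOA_A hS a_pos consts_valid hLQ283 hT (d := dO) hNo hCCo' hAOPo' tSO
    have hSe := hSe_of_checkCellE hS a_pos primeData consts_valid χ hε hLQ283 hT (d := dE) (by omega) hCCe' tE tPE
    have hSo := hSo_of_checkCellO hS a_pos primeData consts_valid χ hε hLQ283 hT (d := dO) (by omega) hCCo' tO tPO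
    have hθe : (0 : ℝ) < (dE.θN : ℝ) / dE.θD := by positivity
    have hθo : (0 : ℝ) < (dO.θN : ℝ) / dO.θD := by positivity
    have h := weilPositivityOnChar_of_twisted_formatC_dataAW (q := 283) (by norm_num) χ hreal a_pos
      (Be := dE.B) (B3e := dE.B3) hB2 hBB3 (θe := (dE.θN : ℝ) / dE.θD)
      (d0e := (dE.d0N : ℝ) / 2 ^ dE.wbits) hθe (fun m ↦ (dE.wN.getD (m - dE.B) 0 : ℝ) / 2 ^ dE.wbits)
      h0e hd0e hwe hSe
      (Bo := dO.B) (B3o := dO.B3) hB1 hBB3o (θo := (dO.θN : ℝ) / dO.θD) (d0o := (dO.d0N : ℝ) / 2 ^ dO.wbits) hθo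
      (fun l ↦ (dO.wN.getD (l - dO.B) 0 : ℝ) / 2 ^ dO.wbits) h0o hd0o hwo hSo
    simpa only [a] using h

/-- the even cell: all `10` rows and the header — `checkCellE = true`. [folklore] -/
theorem tE283 : checkCellE (2 ^ 80) C εs283 LQ283 tab dE283 60 21 DE283 = true :=
  checkCellE_of_rows (by decide +kernel) (checkCellERows_glue (checkCellERows_glue (checkCellERows_glue (checkCellERows_glue (checkCellERows_glue (checkCellERows_glue (checkCellERows_glue (checkCellERows_glue (checkCellERows_glue tE283r0 tE283r1 rfl rfl) tE283r2 rfl rfl) tE283r3 rfl rfl) tE283r4 rfl rfl) tE283r5 rfl rfl) tE283r6 rfl rfl) tE283r7 rfl rfl) tE283r8 rfl rfl) tE283r9 rfl rfl) (le_refl _)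

/-- ★★★ **The PRINCIPAL character mod 283 is Weil-positive on `[−(log 12)/2, (log 12)/2]`** (`WeilPositivityOnChar (1 : DirichletCharacter ℂ 283) ((log 12)/2)`; door E with the
character-weighted constant on the `(log 12)/2` table; blocks `10 × 127 ∣ 16 × 40`, kernel margins `λ = 0.0010 ∣ 2.1948`).  With `UniformFloor.WeilPositivityOnChar.of_principal`
this is `U_{(log 12)/2}(283)` (assembled in `UniformConductorFloorLog12Primes.lean`). [cite: Yoshida1992HermitianForms, §7 pp. 305–312] -/
theorem weilPositivityOnChar_log12half_principal_mod_twoEightyThree : WeilPositivityOnChar (1 : DirichletCharacter ℂ 283) (Real.log 12 / 2) := by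
    have hreal : ∀ n : ℕ, conj ((1 : DirichletCharacter ℂ 283) (n : ZMod 283)) = (1 : DirichletCharacter ℂ 283) (n : ZMod 283) := by
      intro n
      by_cases hx : IsUnit ((n : ℕ) : ZMod 283)
      · rw [MulChar.one_apply hx, map_one]
      · rw [MulChar.map_nonunit _ hx, map_zero]
    have hε : ∀ i < ks.length, ((1 : DirichletCharacter ℂ 283) (((ks.getD i default).val : ℕ) : ZMod 283)).re = ((εs283.getD i 0 : ℤ) : ℝ) := by
      intro i hi
      have hi8 : i < 8 := by simpa [ks] using hi
      interval_cases i
      · show ((1 : DirichletCharacter ℂ 283) (((PrimeLen.val ⟨2, 1⟩ : ℕ)) : ZMod 283)).re = (((1 : ℤ)) : ℝ)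
        rw [show (PrimeLen.val ⟨2, 1⟩ : ℕ) = 2 from rfl,
          MulChar.one_apply (show IsUnit ((2 : ℕ) : ZMod 283) by rw [ZMod.isUnit_iff_coprime]; decide)]
        simp
      · show ((1 : DirichletCharacter ℂ 283) (((PrimeLen.val ⟨3, 1⟩ : ℕ)) : ZMod 283)).re = (((1 : ℤ)) : ℝ)
        rw [show (PrimeLen.val ⟨3, 1⟩ : ℕ) = 3 from rfl,
          MulChar.one_apply (show IsUnit ((3 : ℕ) : ZMod 283) by rw [ZMod.isUnit_iff_coprime]; decide)]
        simp
      · show ((1 : DirichletCharacter ℂ 283) (((PrimeLen.val ⟨2, 2⟩ : ℕ)) : ZMod 283)).re = (((1 : ℤ)) : ℝ)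
        rw [show (PrimeLen.val ⟨2, 2⟩ : ℕ) = 4 from rfl,
          MulChar.one_apply (show IsUnit ((4 : ℕ) : ZMod 283) by rw [ZMod.isUnit_iff_coprime]; decide)]
        simp
      · show ((1 : DirichletCharacter ℂ 283) (((PrimeLen.val ⟨5, 1⟩ : ℕ)) : ZMod 283)).re = (((1 : ℤ)) : ℝ)
        rw [show (PrimeLen.val ⟨5, 1⟩ : ℕ) = 5 from rfl,
          MulChar.one_apply (show IsUnit ((5 : ℕ) : ZMod 283) by rw [ZMod.isUnit_iff_coprime]; decide)]
        simp
      · show ((1 : DirichletCharacter ℂ 283) (((PrimeLen.val ⟨7, 1⟩ : ℕ)) : ZMod 283)).re = (((1 : ℤ)) : ℝ)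
        rw [show (PrimeLen.val ⟨7, 1⟩ : ℕ) = 7 from rfl,
          MulChar.one_apply (show IsUnit ((7 : ℕ) : ZMod 283) by rw [ZMod.isUnit_iff_coprime]; decide)]
        simp
      · show ((1 : DirichletCharacter ℂ 283) (((PrimeLen.val ⟨2, 3⟩ : ℕ)) : ZMod 283)).re = (((1 : ℤ)) : ℝ)
        rw [show (PrimeLen.val ⟨2, 3⟩ : ℕ) = 8 from rfl,
          MulChar.one_apply (show IsUnit ((8 : ℕ) : ZMod 283) by rw [ZMod.isUnit_iff_coprime]; decide)]
        simp
      · show ((1 : DirichletCharacter ℂ 283) (((PrimeLen.val ⟨3, 2⟩ : ℕ)) : ZMod 283)).re = (((1 : ℤ)) : ℝ)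
        rw [show (PrimeLen.val ⟨3, 2⟩ : ℕ) = 9 from rfl,
          MulChar.one_apply (show IsUnit ((9 : ℕ) : ZMod 283) by rw [ZMod.isUnit_iff_coprime]; decide)]
        simp
      · show ((1 : DirichletCharacter ℂ 283) (((PrimeLen.val ⟨11, 1⟩ : ℕ)) : ZMod 283)).re = (((1 : ℤ)) : ℝ)
        rw [show (PrimeLen.val ⟨11, 1⟩ : ℕ) = 11 from rfl,
          MulChar.one_apply (show IsUnit ((11 : ℕ) : ZMod 283) by rw [ZMod.isUnit_iff_coprime]; decide)]
        simp
    exact rung283 1 hreal hε (by decide) (by decide) rfl rfl rfl rfl tSE283 tSO283 tE283 tPE283 tO283 tPO283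

end Summit.Ventures.WeilGRH.PrincipalMod283Log12

end
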